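import Literature.NumberTheory.ComplexMultiplication.FiniteQAlgebraLatticeLocalization
import Mathlib.Data.Nat.ChineseRemainder
import Mathlib.Data.Nat.Factorization.Basic
import HarnessLib

/-!
# THE LOCAL QUOTIENTS `(L_3)_(p)/(L_4)_(p)` of a pair of full lattices `L_4 ⊆ L_3` of an ARBITRARY finite-dimensional
# commutative `ℚ`-algebra `A`: `L_3/L_4 ≅ ⊕_p (L_3)_(p)/(L_4)_(p)` — only the primes dividing an exponent `D`
# (`DL_3 ⊆ L_4`) contribute, the map is injective (`L = ⋂_p L_(p)`) and surjective (Chinese remainder theorem for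
# the moduli `p^{v_p(D)}`), each local factor is the image of `L_3` and is `p^{v_p(D)}`-torsion; `(L_1 ∩ L_2)_(p) =
# (L_1)_(p) ∩ (L_2)_(p)`; and for an order `Λ` and a `Λ`-ideal `L`, `a + L` is a unit of `Λ/L` iff it is a unit of
# `Λ_(p)/L_(p)` for every `p` (Hertling–Larabi 2026 Thm. 7.2 (a), (d), Thm. 7.6 (a)) — def-free, nilpotents allowed

[topic NumberTheory/ComplexMultiplication] General-`A` series (namespace
`Literature.NumberTheory.ComplexMultiplication.FiniteQAlgebraLattice`); sequel of `FiniteQAlgebraLatticeLocalization`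
(the def-free localisations «`x ∈ L_(p)`» = `∃ s : ℤ, ¬ ↑p ∣ s ∧ s • x ∈ L`, «`L_1`, `L_2` agree at `p`» =
`∃ s : ℤ, ¬ ↑p ∣ s ∧ (∀ x ∈ L_1, s • x ∈ L_2) ∧ (∀ x ∈ L_2, s • x ∈ L_1)`; Thm. 7.2 (a) for products ∕ colons ∕ units,
(b), (c), `L = ⋂_p L_(p)` = `mem_of_forall_prime_exists_coprime_smul_mem` — REUSED by name) and of
`FiniteQAlgebraLatticeOrderExtensionKernel` (Thm. 7.2 (a) for sums, `locEq_sup`).  This file supplies what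
`FiniteQAlgebraLatticeLocalization` lists as NOT there: THEOREM 7.2 (a) for INTERSECTIONS, THEOREM 7.2 (d), and the
unit-group clause of THEOREM 7.6 (a) (whose surjectivity clause for an order is `FiniteQAlgebraLatticeConductorKernelBijection`'s
`exists_mem_forall_locEq_sub`; here the module version for any pair `L_4 ⊆ L_3`, no ring structure on the lattices).
Lane `lit-hodgefound` (Track 2 foundations library), seat p19 generation 37, row g37-#3.  THEOREMS ONLY: no
definition, no instance, no notation, no named fact (D-0026, net Literature debt `0`), no `sorry`.

DEF-FREE SPELLING (continued).  The natural map (7.1) `L_3/L_4 → ⊕_{p} (L_3)_(p)/(L_4)_(p)` is never built as an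
object: «`x ≡ y (mod (L_4)_(p))`» is `∃ s : ℤ, ¬ ↑p ∣ s ∧ s • (x − y) ∈ L_4`; INJECTIVITY of (7.1) says `x ∈ L_3` with
`x ≡ 0 (mod (L_4)_(p))` for all (relevant) `p` lies in `L_4`; SURJECTIVITY says prescribed classes `c_p + (L_4)_(p)`,
`p ∈ P_0`, are simultaneously hit by one `a ∈ L_3`, and that every class of `(L_3)_(p)/(L_4)_(p)` has a representative
in `L_3`.  The exponent `D ∈ ℕ ∖ 0` with `DL_3 ⊆ L_4` (it exists for full lattices, `exists_ne_zero_forall_natCast_smul_mem`)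
replaces HL's finite set `{p | (L_3)_(p) ≠ (L_4)_(p)}` by the set of prime divisors of `D` containing it
(`locEq_of_not_dvd`); `v_p(D)` is `D.factorization p`.

## Source, VERBATIM

C. Hertling, K. Larabi, *Semigroups from full lattices in commutative ℚ-algebras*, arXiv:2602.14973 (2026)
[HertlingLarabi2026], held `paper:arxiv-2602.14973`, §7 (chunks p0018–p0019) — `A` «a finite dimensional
commutative ℚ-algebra with unit element» (Thm. 3.1), not assumed separable: «**Theorem 7.2.** Let `V` be an
`n`-dimensional ℚ-vector space for some `n ∈ ℕ`. Let `L_1, L_2, L_3` and `L_4` be full lattices in `V` with `L_3 ⊃ L_4`.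
(a) `L_1 = ⋂_{p∈ℙ} (L_1)_(p)` and for each `p ∈ ℙ` `(L_1 + L_2)_(p) = (L_1)_(p) + (L_2)_(p)`,
`(L_1 ∩ L_2)_(p) = (L_1)_(p) ∩ (L_2)_(p)`, […] (b) The subset of `ℙ` of elements `p` with `(L_1)_(p) ≠ (L_2)_(p)` is
finite. […] (d) There is a natural isomorphism `L_3/L_4 ≅ ⊕_{p∈ℙ: (L_3)_(p)≠(L_4)_(p)} (L_3)_(p)/(L_4)_(p)` as torsion
`ℤ`-modules respectively finite additive groups. Observe that by part (b) the set `{p ∈ ℙ | (L_3)_(p) ≠ (L_4)_(p)}`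
is finite. […] **Theorem 7.6.** Let `A` be as in Theorem 3.1. Let `Λ` be an order, and let `L ⊂ Λ` be a `Λ`-ideal
(not necessarily exact). The set `P_0 := {p ∈ ℙ | Λ_(p) ≠ L_(p)}` is finite by Theorem 7.2 (b). (a) The quotient
`Λ/L` is a finite commutative ring with unit element. For each `p ∈ P_0` the quotient `Λ_(p)/L_(p)` is a finite
commutative ring with unit element. There is a natural isomorphism `Λ/L → ∏_{p∈P_0} Λ_(p)/L_(p)` of finite
commutative rings with unit elements. It induces an isomorphism `(Λ/L)^{unit} → ∏_{p∈P_0} (Λ_(p)/L_(p))^{unit}` of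
finite commutative multiplicative groups (of units in the rings). […] *Proof:* (a) By Theorem (7.2) (d) there is a
natural map as in (7.4) which is an isomorphism between finite additive groups. Obviously for `a, b ∈ L`
`Λ/L ∋ (a + L)(b + L) ↦ ∏_{p∈P_0}((a + L_(p))(b + L_(p))) = (∏_{p∈P_0}(a + L_(p)))·(∏_{p∈P_0}(b + L_(p)))
∈ ∏_{p∈P_0} Λ_(p)/L_(p)`, so it is an isomorphism between finite commutative rings with unit elements.»

## What is proved (`M, N, L₃, L₄, Λ, L : Submodule ℤ A`; `p : ℕ` prime; `D : ℕ`, `D ≠ 0`, `D • L₃ ⊆ L₄`)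

* §1 THEOREM 7.2 (a) for INTERSECTIONS (any commutative ring): **`locEq_inf`** (agreement at `p` is compatible
  with `∩`), `exists_not_dvd_smul_mem_inf_iff` (`x ∈ (L_1 ∩ L_2)_(p) ⟺ x ∈ (L_1)_(p) ∩ (L_2)_(p)`), and the
  membership form of the sum rule `exists_not_dvd_smul_mem_sup_iff` (`x ∈ (L_1 + L_2)_(p) ⟺ x = y + z`,
  `y ∈ (L_1)_(p)`, `z ∈ (L_2)_(p)`; `ℚ`-algebra).
* §2 THEOREM 7.2 (d), def-free, for `L_4 ⊆ L_3` with `DL_3 ⊆ L_4` (`exists_ne_zero_forall_natCast_smul_mem`: such a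
  `D` exists when `L_4` is full and `L_3` finitely generated): `locEq_of_not_dvd` (only prime divisors of `D` see a
  difference), INJECTIVITY **`mem_of_forall_prime_dvd_exists_not_dvd_smul_mem`** (`x ∈ L_3` vanishing in every
  `(L_3)_(p)/(L_4)_(p)`, `p ∣ D`, lies in `L_4`), SURJECTIVITY **`exists_mem_forall_smul_sub_mem`** (Chinese
  remainder theorem: classes `c_p + (L_4)_(p)`, `p ∈ P_0`, are hit by one `a ∈ L_3`), the local factors **`exists_mem_smul_sub_mem_of_smul_mem`** (every class of `(L_3)_(p)/(L_4)_(p)` has a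
  representative in `L_3`, i.e. `(L_3)_(p)/(L_4)_(p) = L_3/(L_3 ∩ (L_4)_(p))`) and their exponent
  `exists_not_dvd_smul_pow_smul_mem` (`p^{v_p(D)}·(L_3)_(p) ⊆ (L_4)_(p)`: the `p`-component is `p^{v_p(D)}`-torsion).
* §3 THEOREM 7.6 (a), unit groups, for an order `Λ` (`1 ∈ Λ`, `ΛΛ ⊆ Λ`) and a `Λ`-ideal `L` (`ΛL ⊆ L`,
  `DΛ ⊆ L`): **`exists_mul_sub_one_mem_iff_forall_prime_dvd`** (`a + L ∈ (Λ/L)^{unit}` iff `a + L_(p) ∈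
  (Λ_(p)/L_(p))^{unit}` for every `p ∣ D`) and `exists_mul_sub_one_mem_iff_forall_prime` (… for every prime `p`).
NOT here: the finiteness `#(Λ/L) < ∞` (window finiteness, `FiniteQAlgebraLatticeLocallyPrincipal`), Thm. 7.6 (b)
(`FiniteQAlgebraLatticeOrderExtensionKernel`).

## References
* [HertlingLarabi2026] C. Hertling, K. Larabi, arXiv:2602.14973 (2026), §7 Thm. 7.2 (a), (d) (chunk p0018), Thm. 7.6
  (a) and proof (chunk p0019). [cite: HertlingLarabi2026, §7 Thm. 7.2 (d) and Thm. 7.6 (a), chunks p0018–p0019]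
* [Faddeev1965] D. K. Faddeev, Trudy Mat. Inst. Steklov 80 (1965) 145–182, cited as [Fa65] for Thm. 7.2.
  [cite: Faddeev1965, as cited by HertlingLarabi2026 §7 Thm. 7.2]
-/

noncomputable section

open scoped Pointwise
open Module Function

open Literature.NumberTheory.Automorphic (IsFullLattice exists_smul_mem_of_fg)

namespace Literature.NumberTheory.ComplexMultiplication.FiniteQAlgebraLattice

section LocalQuotients

variable {A : Type} [CommRing A] [Algebra ℚ A]

/-! ## §0 Primes, `p`-parts and prime-to-`p` parts of an exponent (file-local bookkeeping) -/

/-- `p ∤ s`, `p ∤ s′ ⟹ p ∤ ss′` in `ℤ` (file-local). [folklore] -/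
private theorem not_dvd_mul_int₂ {p : ℕ} (hp : p.Prime) {s s' : ℤ} (hs : ¬ (p : ℤ) ∣ s) (hs' : ¬ (p : ℤ) ∣ s') :
    ¬ (p : ℤ) ∣ s * s' :=
  fun h => ((Nat.prime_iff_prime_int.1 hp).dvd_or_dvd h).elim hs hs'

/-- `p` does not divide the prime-to-`p` part `D / p^{v_p(D)}` of `D ≠ 0` (file-local). [folklore] -/
private theorem not_dvd_ordCompl_int {p D : ℕ} (hp : p.Prime) (hD : D ≠ 0) :
    ¬ (p : ℤ) ∣ ((D / p ^ D.factorization p : ℕ) : ℤ) := fun h =>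
  (hp.coprime_iff_not_dvd.1 (Nat.coprime_ordCompl hp hD)) (Int.natCast_dvd_natCast.1 h)

/-- `(D / p^{v_p(D)})·p^{v_p(D)} = D` in `ℤ` (file-local). [folklore] -/
private theorem ordCompl_mul_ordProj_int (p D : ℕ) :
    ((D / p ^ D.factorization p : ℕ) : ℤ) * ((p ^ D.factorization p : ℕ) : ℤ) = D := by
  rw [← Nat.cast_mul, Nat.div_mul_cancel (Nat.ordProj_dvd D p)]

omit [Algebra ℚ A] in
/-- `D • y ∈ L`, `D ∣ k ⟹ k • y ∈ L` (file-local). [folklore] -/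
private theorem smul_mem_of_dvd_of_smul_mem {L : Submodule ℤ A} {y : A} {D k : ℤ} (hDy : D • y ∈ L)
    (hk : D ∣ k) : k • y ∈ L := by
  obtain ⟨m, rfl⟩ := hk
  rw [mul_comm, mul_smul]
  exact L.smul_mem m hDy

/-! ## §1 Theorem 7.2 (a): `(L_1 ∩ L_2)_(p) = (L_1)_(p) ∩ (L_2)_(p)` (and the membership form of the sum rule) -/

omit [Algebra ℚ A] in
/-- **THEOREM 7.2 (a): agreement at `p` is compatible with INTERSECTIONS**, `(L_1 ∩ L_2)_(p) = (L_1)_(p) ∩ (L_2)_(p)`.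
[cite: HertlingLarabi2026, §7 Thm. 7.2 (a), chunk p0018] -/
theorem locEq_inf {p : ℕ} (hp : p.Prime) {M M' N N' : Submodule ℤ A}
    (hM : ∃ s : ℤ, ¬ (p : ℤ) ∣ s ∧ (∀ x ∈ M, s • x ∈ M') ∧ (∀ x ∈ M', s • x ∈ M))
    (hN : ∃ s : ℤ, ¬ (p : ℤ) ∣ s ∧ (∀ x ∈ N, s • x ∈ N') ∧ (∀ x ∈ N', s • x ∈ N)) :
    ∃ s : ℤ, ¬ (p : ℤ) ∣ s ∧ (∀ x ∈ M ⊓ N, s • x ∈ M' ⊓ N') ∧ (∀ x ∈ M' ⊓ N', s • x ∈ M ⊓ N) := by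
  obtain ⟨s, hs, h₁, h₂⟩ := hM
  obtain ⟨s', hs', h₃, h₄⟩ := hN
  refine ⟨s * s', not_dvd_mul_int₂ hp hs hs', fun x hx => ?_, fun x hx => ?_⟩
  · obtain ⟨hxM, hxN⟩ := Submodule.mem_inf.1 hx
    exact Submodule.mem_inf.2 ⟨by rw [mul_comm, mul_smul]; exact M'.smul_mem _ (h₁ x hxM),
      by rw [mul_smul]; exact N'.smul_mem _ (h₃ x hxN)⟩
  · obtain ⟨hxM, hxN⟩ := Submodule.mem_inf.1 hx
    exact Submodule.mem_inf.2 ⟨by rw [mul_comm, mul_smul]; exact M.smul_mem _ (h₂ x hxM),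
      by rw [mul_smul]; exact N.smul_mem _ (h₄ x hxN)⟩

omit [Algebra ℚ A] in
/-- **THEOREM 7.2 (a), membership form: `x ∈ (L_1 ∩ L_2)_(p) ⟺ x ∈ (L_1)_(p)` and `x ∈ (L_2)_(p)`.**
[cite: HertlingLarabi2026, §7 Thm. 7.2 (a), chunk p0018] -/
theorem exists_not_dvd_smul_mem_inf_iff {p : ℕ} (hp : p.Prime) {M N : Submodule ℤ A} {x : A} :
    (∃ s : ℤ, ¬ (p : ℤ) ∣ s ∧ s • x ∈ M ⊓ N) ↔
      (∃ s : ℤ, ¬ (p : ℤ) ∣ s ∧ s • x ∈ M) ∧ (∃ s : ℤ, ¬ (p : ℤ) ∣ s ∧ s • x ∈ N) := by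
  constructor
  · rintro ⟨s, hs, hsx⟩
    exact ⟨⟨s, hs, (Submodule.mem_inf.1 hsx).1⟩, ⟨s, hs, (Submodule.mem_inf.1 hsx).2⟩⟩
  · rintro ⟨⟨s, hs, hsx⟩, ⟨s', hs', hs'x⟩⟩
    refine ⟨s * s', not_dvd_mul_int₂ hp hs hs', Submodule.mem_inf.2 ⟨?_, ?_⟩⟩
    · rw [mul_comm, mul_smul]; exact M.smul_mem _ hsx
    · rw [mul_smul]; exact N.smul_mem _ hs'x

/-- **THEOREM 7.2 (a), membership form of the sum rule: `x ∈ (L_1 + L_2)_(p)` iff `x = y + z` with `y ∈ (L_1)_(p)`,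
`z ∈ (L_2)_(p)`** (in a `ℚ`-algebra: `y = s⁻¹m`, `z = s⁻¹n` for `sx = m + n`).
[cite: HertlingLarabi2026, §7 Thm. 7.2 (a), chunk p0018] -/
theorem exists_not_dvd_smul_mem_sup_iff {p : ℕ} (hp : p.Prime) {M N : Submodule ℤ A} {x : A} :
    (∃ s : ℤ, ¬ (p : ℤ) ∣ s ∧ s • x ∈ M ⊔ N) ↔
      ∃ y z : A, (∃ s : ℤ, ¬ (p : ℤ) ∣ s ∧ s • y ∈ M) ∧ (∃ s : ℤ, ¬ (p : ℤ) ∣ s ∧ s • z ∈ N) ∧ x = y + z := by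
  constructor
  · rintro ⟨s, hs, hsx⟩
    obtain ⟨m, hm, n, hn, hmn⟩ := Submodule.mem_sup.1 hsx
    have hs0 : (s : ℚ) ≠ 0 := by
      exact_mod_cast fun h => hs (by rw [h]; exact dvd_zero _)
    refine ⟨(s : ℚ)⁻¹ • m, (s : ℚ)⁻¹ • n, ⟨s, hs, ?_⟩, ⟨s, hs, ?_⟩, ?_⟩
    · rwa [← Int.cast_smul_eq_zsmul ℚ, smul_smul, mul_inv_cancel₀ hs0, one_smul]
    · rwa [← Int.cast_smul_eq_zsmul ℚ, smul_smul, mul_inv_cancel₀ hs0, one_smul]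
    · rw [← smul_add, hmn, ← Int.cast_smul_eq_zsmul ℚ, smul_smul, inv_mul_cancel₀ hs0, one_smul]
  · rintro ⟨y, z, ⟨s, hs, hsy⟩, ⟨s', hs', hs'z⟩, rfl⟩
    refine ⟨s * s', not_dvd_mul_int₂ hp hs hs', ?_⟩
    rw [smul_add]
    refine Submodule.add_mem_sup ?_ ?_
    · rw [mul_comm, mul_smul]; exact M.smul_mem _ hsy
    · rw [mul_smul]; exact N.smul_mem _ hs'z

/-! ## §2 Theorem 7.2 (d): `L_3/L_4 ≅ ⊕_p (L_3)_(p)/(L_4)_(p)`, def-free -/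

omit [Algebra ℚ A] in
/-- **The exponent `D`: for `L_4` full and `L_3` finitely generated some `D ∈ ℕ ∖ 0` has `DL_3 ⊆ L_4`** (HL's «torsion
`ℤ`-modules respectively finite additive groups»). [cite: HertlingLarabi2026, §7 Thm. 7.2 (d), chunk p0018] -/
theorem exists_ne_zero_forall_natCast_smul_mem {L₃ L₄ : Submodule ℤ A} (hL₄ : IsFullLattice A L₄)
    (hL₃ : L₃.FG) : ∃ D : ℕ, D ≠ 0 ∧ ∀ y ∈ L₃, (D : ℤ) • y ∈ L₄ := by
  obtain ⟨n, hn, hnL⟩ := exists_smul_mem_of_fg hL₄ hL₃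
  refine ⟨n.natAbs, Int.natAbs_ne_zero.2 hn, fun y hy => ?_⟩
  rcases Int.natAbs_eq n with h | h
  · rw [← h]; exact hnL y hy
  · rw [show (n.natAbs : ℤ) = -n by omega, neg_smul]; exact L₄.neg_mem (hnL y hy)

omit [Algebra ℚ A] in
/-- **Only the prime divisors of `D` see a difference: for `L_4 ⊆ L_3`, `DL_3 ⊆ L_4` and `p ∤ D`, `L_3` and `L_4` AGREE
at `p`** (so HL's `{p | (L_3)_(p) ≠ (L_4)_(p)}` lies among the prime divisors of `D`, Thm. 7.2 (b)).
[cite: HertlingLarabi2026, §7 Thm. 7.2 (b), (d), chunk p0018] -/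
theorem locEq_of_not_dvd {L₃ L₄ : Submodule ℤ A} (hle : L₄ ≤ L₃) {D : ℕ}
    (hDL : ∀ y ∈ L₃, (D : ℤ) • y ∈ L₄) {p : ℕ} (hpD : ¬ p ∣ D) :
    ∃ s : ℤ, ¬ (p : ℤ) ∣ s ∧ (∀ x ∈ L₃, s • x ∈ L₄) ∧ (∀ x ∈ L₄, s • x ∈ L₃) :=
  ⟨D, fun h => hpD (Int.natCast_dvd_natCast.1 h), hDL, fun _ hx => L₃.smul_mem _ (hle hx)⟩

omit [Algebra ℚ A] in
/-- **THEOREM 7.2 (d), INJECTIVITY of `L_3/L_4 → ⊕_p (L_3)_(p)/(L_4)_(p)`: an `x ∈ L_3` lying in `(L_4)_(p)` for every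
prime `p ∣ D` (`DL_3 ⊆ L_4`) lies in `L_4`** — at the other primes `Dx ∈ L_4` already; then `L_4 = ⋂_p (L_4)_(p)`
(Thm. 7.2 (a)). [cite: HertlingLarabi2026, §7 Thm. 7.2 (a), (d), chunk p0018] -/
theorem mem_of_forall_prime_dvd_exists_not_dvd_smul_mem {L₃ L₄ : Submodule ℤ A} {D : ℕ}
    (hDL : ∀ y ∈ L₃, (D : ℤ) • y ∈ L₄) {x : A} (hx : x ∈ L₃)
    (h : ∀ p : ℕ, p.Prime → p ∣ D → ∃ s : ℤ, ¬ (p : ℤ) ∣ s ∧ s • x ∈ L₄) : x ∈ L₄ :=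
  mem_of_forall_prime_exists_coprime_smul_mem fun p hp => by
    by_cases hpD : p ∣ D
    · exact h p hp hpD
    · exact ⟨D, fun h' => hpD (Int.natCast_dvd_natCast.1 h'), hDL x hx⟩

omit [Algebra ℚ A] in
/-- **THEOREM 7.2 (d), SURJECTIVITY of `L_3/L_4 → ⊕_{p∈P_0} (L_3)_(p)/(L_4)_(p)` (Chinese remainder theorem): for
`DL_3 ⊆ L_4` (`D ≠ 0`), a finite set `P_0` of primes and elements `c_p ∈ L_3` (`p ∈ P_0`) there is `a ∈ L_3` with
`a ≡ c_p (mod (L_4)_(p))` for every `p ∈ P_0`** — `a = Σ_q ε_q c_q` with integers `ε_q ≡ δ_{pq} (mod p^{v_p(D)})` for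
all `p ∈ P_0`; then `(D/p^{v_p(D)})·(a − c_p) ∈ DL_3 ⊆ L_4`.  No ring structure on `L_3` is used (module version of
`FiniteQAlgebraLatticeConductorKernelBijection.exists_mem_forall_locEq_sub`).
[cite: HertlingLarabi2026, §7 Thm. 7.2 (d) and Thm. 7.6 (a) («There is a natural isomorphism Λ/L → ∏_{p∈P_0} Λ_(p)/L_(p)»), chunks p0018–p0019] -/
theorem exists_mem_forall_smul_sub_mem {L₃ L₄ : Submodule ℤ A} {D : ℕ} (hD : D ≠ 0)
    (hDL : ∀ y ∈ L₃, (D : ℤ) • y ∈ L₄) (P₀ : Finset ℕ) (hP₀ : ∀ p ∈ P₀, p.Prime) {c : ℕ → A}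
    (hc : ∀ p ∈ P₀, c p ∈ L₃) :
    ∃ a ∈ L₃, ∀ p ∈ P₀, ∃ s : ℤ, ¬ (p : ℤ) ∣ s ∧ s • (a - c p) ∈ L₄ := by
  classical
  -- moduli `q^{v_q(D)}`, `q ∈ P_0`, pairwise coprime
  have hs0 : ∀ q ∈ P₀, (fun r => r ^ D.factorization r) q ≠ 0 := fun q hq => pow_ne_zero _ (hP₀ q hq).ne_zero
  have hpp : Set.Pairwise (↑P₀ : Set ℕ) (Nat.Coprime on fun r => r ^ D.factorization r) :=
    fun q hq r hr hqr => Nat.coprime_pow_primes _ _ (hP₀ q hq) (hP₀ r hr) hqr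
  -- `ε_q ≡ δ_{qr} (mod r^{v_r(D)})` for all `r ∈ P_0`
  have hε : ∀ q : ℕ, ∃ ε : ℕ, ∀ r ∈ P₀, ε ≡ (if r = q then 1 else 0) [MOD r ^ D.factorization r] := fun q =>
    let k := Nat.chineseRemainderOfFinset (fun r => if r = q then 1 else 0) (fun r => r ^ D.factorization r)
      P₀ hs0 hpp
    ⟨k.1, k.2⟩
  choose ε hε using hε
  refine ⟨∑ q ∈ P₀, (ε q : ℤ) • c q, Submodule.sum_mem _ fun q hq => L₃.smul_mem _ (hc q hq), fun p hp => ?_⟩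
  refine ⟨(D / p ^ D.factorization p : ℕ), not_dvd_ordCompl_int (hP₀ p hp) hD, ?_⟩
  have hsum : (∑ q ∈ P₀, (ε q : ℤ) • c q) - c p = ∑ q ∈ P₀, ((ε q : ℤ) - if p = q then 1 else 0) • c q := by
    simp only [sub_smul, Finset.sum_sub_distrib, ite_smul, one_smul, zero_smul, Finset.sum_ite_eq, if_pos hp]
  rw [hsum, Finset.smul_sum]
  refine Submodule.sum_mem _ fun q hq => ?_
  rw [smul_smul]
  refine smul_mem_of_dvd_of_smul_mem (hDL _ (hc q hq)) ?_
  -- `D ∣ (D/p^{v_p(D)})·(ε_q − δ_{pq})` because `p^{v_p(D)} ∣ ε_q − δ_{pq}`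
  have h1 : ((p ^ D.factorization p : ℕ) : ℤ) ∣ (ε q : ℤ) - (if p = q then 1 else 0 : ℤ) := by
    have h2 := (Nat.modEq_iff_dvd.1 (hε q p hp))
    rw [← dvd_neg, neg_sub]
    push_cast at h2
    exact h2
  obtain ⟨k, hk⟩ := h1
  refine ⟨k, ?_⟩
  rw [hk, ← mul_assoc, ordCompl_mul_ordProj_int]

omit [Algebra ℚ A] in
/-- **THEOREM 7.2 (d), the local factors: every class of `(L_3)_(p)/(L_4)_(p)` has a representative in `L_3`** — for
`x ∈ (L_3)_(p)` (`sx ∈ L_3`, `p ∤ s`) there is `y ∈ L_3` with `x ≡ y (mod (L_4)_(p))`; so `(L_3)_(p)/(L_4)_(p) =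
L_3/(L_3 ∩ (L_4)_(p))` and `Λ → Λ_(p)/L_(p)` is onto (`DL_3 ⊆ L_4`, `D ≠ 0`; `y = t·sx` with `ts ≡ 1 (mod p^{v_p(D)})`).
[cite: HertlingLarabi2026, §7 Thm. 7.2 (d) and Thm. 7.6 (a), chunks p0018–p0019] -/
theorem exists_mem_smul_sub_mem_of_smul_mem {L₃ L₄ : Submodule ℤ A} {D : ℕ} (hD : D ≠ 0)
    (hDL : ∀ y ∈ L₃, (D : ℤ) • y ∈ L₄) {p : ℕ} (hp : p.Prime) {x : A} {s : ℤ} (hs : ¬ (p : ℤ) ∣ s)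
    (hsx : s • x ∈ L₃) : ∃ y ∈ L₃, ∃ s' : ℤ, ¬ (p : ℤ) ∣ s' ∧ s' • (x - y) ∈ L₄ := by
  -- `u·p^{v_p(D)} + t·s = 1`
  have hcop : IsCoprime ((p : ℤ) ^ D.factorization p) s :=
    (((Nat.prime_iff_prime_int.1 hp).coprime_iff_not_dvd.2 hs).pow_left)
  obtain ⟨u, t, hut⟩ := hcop
  refine ⟨t • (s • x), L₃.smul_mem t hsx, (D / p ^ D.factorization p : ℕ) * s,
    not_dvd_mul_int₂ hp (not_dvd_ordCompl_int hp hD) hs, ?_⟩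
  -- `(D/p^v · s)·(x − tsx) = (u·D)·(sx)`
  have key : (((D / p ^ D.factorization p : ℕ) : ℤ) * s) • (x - t • (s • x)) =
      (u * (D : ℤ)) • (s • x) := by
    have h1 : x - t • (s • x) = (u * (p : ℤ) ^ D.factorization p) • x := by
      rw [smul_smul, eq_sub_of_add_eq hut, sub_smul, one_smul]
    rw [h1, smul_smul, smul_smul]
    congr 1
    rw [← ordCompl_mul_ordProj_int p D]; push_cast; ring
  rw [key, mul_smul]
  exact L₄.smul_mem u (hDL _ hsx)

omit [Algebra ℚ A] in
/-- **THEOREM 7.2 (d), the exponent of the `p`-component: `p^{v_p(D)}·(L_3)_(p) ⊆ (L_4)_(p)`** (for `x ∈ L_3`,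
`(D/p^{v_p(D)})·p^{v_p(D)}x = Dx ∈ L_4` with `p ∤ D/p^{v_p(D)}`): the finite abelian group `(L_3)_(p)/(L_4)_(p)` is
killed by `p^{v_p(D)}` («torsion `ℤ`-modules respectively finite additive groups»).
[cite: HertlingLarabi2026, §7 Thm. 7.2 (d), chunk p0018] -/
theorem exists_not_dvd_smul_pow_smul_mem {L₃ L₄ : Submodule ℤ A} {D : ℕ} (hD : D ≠ 0)
    (hDL : ∀ y ∈ L₃, (D : ℤ) • y ∈ L₄) {p : ℕ} (hp : p.Prime) {x : A} (hx : x ∈ L₃) :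
    ∃ s : ℤ, ¬ (p : ℤ) ∣ s ∧ s • (((p ^ D.factorization p : ℕ) : ℤ) • x) ∈ L₄ :=
  ⟨(D / p ^ D.factorization p : ℕ), not_dvd_ordCompl_int hp hD, by
    rw [smul_smul, ordCompl_mul_ordProj_int]; exact hDL x hx⟩

omit [Algebra ℚ A] in
/-- **THEOREM 7.2 (d), injectivity and surjectivity together: for `x ∈ L_3`, `x ∈ L_4` iff `x ∈ (L_4)_(p)` for every
prime `p ∣ D`.** [cite: HertlingLarabi2026, §7 Thm. 7.2 (a), (d), chunk p0018] -/
theorem mem_iff_forall_prime_dvd_exists_not_dvd_smul_mem {L₃ L₄ : Submodule ℤ A} {D : ℕ}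
    (hDL : ∀ y ∈ L₃, (D : ℤ) • y ∈ L₄) {x : A} (hx : x ∈ L₃) :
    x ∈ L₄ ↔ ∀ p : ℕ, p.Prime → p ∣ D → ∃ s : ℤ, ¬ (p : ℤ) ∣ s ∧ s • x ∈ L₄ :=
  ⟨fun h _ hp _ => exists_not_dvd_smul_mem_of_mem hp h,
    mem_of_forall_prime_dvd_exists_not_dvd_smul_mem hDL hx⟩

/-! ## §3 Theorem 7.6 (a): `(Λ/L)^{unit} ≅ ∏_{p∈P_0} (Λ_(p)/L_(p))^{unit}` -/

omit [Algebra ℚ A] in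
/-- **THEOREM 7.6 (a), units: for an order `Λ`, a `Λ`-ideal `L` with `DΛ ⊆ L` (`D ≠ 0`) and `a ∈ Λ`, the class
`a + L` is a unit of `Λ/L` iff `a + L_(p)` is a unit of `Λ_(p)/L_(p)` for every prime `p ∣ D`** («It induces an
isomorphism `(Λ/L)^{unit} → ∏_{p∈P_0}(Λ_(p)/L_(p))^{unit}`»; ⟸: glue local inverses `b_p` by the Chinese remainder
theorem of §2 to `b ∈ Λ`, then `ab − 1 ∈ ⋂_p L_(p) = L`).
[cite: HertlingLarabi2026, §7 Thm. 7.6 (a) and proof, chunk p0019] -/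
theorem exists_mul_sub_one_mem_iff_forall_prime_dvd {Λ L : Submodule ℤ A} (h1 : (1 : A) ∈ Λ)
    (hΛΛ : Λ * Λ ≤ Λ) (hΛL : Λ * L ≤ L) {D : ℕ} (hD : D ≠ 0) (hDL : ∀ y ∈ Λ, (D : ℤ) • y ∈ L)
    {a : A} (ha : a ∈ Λ) :
    (∃ b ∈ Λ, a * b - 1 ∈ L) ↔
      ∀ p : ℕ, p.Prime → p ∣ D → ∃ b ∈ Λ, ∃ s : ℤ, ¬ (p : ℤ) ∣ s ∧ s • (a * b - 1) ∈ L := by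
  classical
  refine ⟨fun ⟨b, hb, hab⟩ _ hp _ => ⟨b, hb, exists_not_dvd_smul_mem_of_mem hp hab⟩, fun h => ?_⟩
  -- local inverses `b_p`, `p ∣ D`
  have hloc : ∀ p : ℕ, ∃ b : A, p ∈ D.primeFactors → b ∈ Λ ∧ ∃ s : ℤ, ¬ (p : ℤ) ∣ s ∧ s • (a * b - 1) ∈ L := by
    intro p
    by_cases hp : p ∈ D.primeFactors
    · obtain ⟨b, hb, hs⟩ := h p (Nat.prime_of_mem_primeFactors hp) (Nat.dvd_of_mem_primeFactors hp)
      exact ⟨b, fun _ => ⟨hb, hs⟩⟩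
    · exact ⟨0, fun hp' => (hp hp').elim⟩
  choose b hb using hloc
  -- glue: `b' ≡ b_p (mod L_(p))` for all `p ∣ D`
  obtain ⟨b', hb'Λ, hb'⟩ := exists_mem_forall_smul_sub_mem (L₃ := Λ) (L₄ := L) hD hDL D.primeFactors
    (fun p hp => Nat.prime_of_mem_primeFactors hp) (c := b) fun p hp => (hb p hp).1
  refine ⟨b', hb'Λ, mem_of_forall_prime_dvd_exists_not_dvd_smul_mem (L₃ := Λ) hDL
    (Λ.sub_mem (hΛΛ (Submodule.mul_mem_mul ha hb'Λ)) h1) fun p hp hpD => ?_⟩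
  have hpmem : p ∈ D.primeFactors := Nat.mem_primeFactors.2 ⟨hp, hpD, hD⟩
  obtain ⟨s, hs, hsb⟩ := hb' p hpmem
  obtain ⟨s', hs', hs'b⟩ := (hb p hpmem).2
  refine ⟨s * s', not_dvd_mul_int₂ hp hs hs', ?_⟩
  -- `ss′(ab′ − 1) = s′·(a·s(b′ − b_p)) + s·(s′(ab_p − 1))`
  have e : (s * s') • (a * b' - 1) = s' • (a * (s • (b' - b p))) + s • (s' • (a * b p - 1)) := by
    simp only [smul_sub, mul_sub, smul_smul, mul_smul_comm, mul_comm s s']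
    abel
  rw [e]
  exact L.add_mem (L.smul_mem s' (hΛL (Submodule.mul_mem_mul ha hsb))) (L.smul_mem s hs'b)

omit [Algebra ℚ A] in
/-- **THEOREM 7.6 (a), units, all primes: `a + L ∈ (Λ/L)^{unit}` iff `a + L_(p) ∈ (Λ_(p)/L_(p))^{unit}` for every
prime `p`** (the factors with `p ∤ D` are trivial rings' unit groups). [cite: HertlingLarabi2026, §7 Thm. 7.6 (a), chunk p0019] -/
theorem exists_mul_sub_one_mem_iff_forall_prime {Λ L : Submodule ℤ A} (h1 : (1 : A) ∈ Λ)
    (hΛΛ : Λ * Λ ≤ Λ) (hΛL : Λ * L ≤ L) {D : ℕ} (hD : D ≠ 0) (hDL : ∀ y ∈ Λ, (D : ℤ) • y ∈ L)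
    {a : A} (ha : a ∈ Λ) :
    (∃ b ∈ Λ, a * b - 1 ∈ L) ↔
      ∀ p : ℕ, p.Prime → ∃ b ∈ Λ, ∃ s : ℤ, ¬ (p : ℤ) ∣ s ∧ s • (a * b - 1) ∈ L := by
  rw [exists_mul_sub_one_mem_iff_forall_prime_dvd h1 hΛΛ hΛL hD hDL ha]
  refine ⟨fun h p hp => ?_, fun h p hp _ => h p hp⟩
  by_cases hpD : p ∣ D
  · exact h p hp hpD
  · -- `p ∤ D`: `Λ_(p) = L_(p)`, every class is a unit: `D·(a·1 − 1) ∈ L`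
    exact ⟨1, h1, D, fun h' => hpD (Int.natCast_dvd_natCast.1 h'),
      hDL _ (Λ.sub_mem (hΛΛ (Submodule.mul_mem_mul ha h1)) h1)⟩

end LocalQuotients

end Literature.NumberTheory.ComplexMultiplication.FiniteQAlgebraLattice
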